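import Mathlib
import HarnessLib

/-!
# `NoHeavyLowerTail` (stmt-CriticalPhenomena-4575) — pairwise adjacent classes form a star or a triangle (L2.1 of U1-PROOF.md)

Support file (prover `prim-gen-swap` gen 13; `--supports stmt-CriticalPhenomena-4575`).  No definitions, no named facts, no sorries.

Classes `X : ι` have port pairs `s(P X, P' X)` with `P X ≠ P' X`; two classes are ADJACENT when they share a port.  Lemma L2.1 of the
seat memo U1-PROOF.md (blueprint B2, used again in L4.1 and L5.2): a nonempty family of classes which is pairwise adjacent is contained
in a STAR (all classes through one port) or in a TRIANGLE (three distinct ports `a, b, c`, every port pair among `ab, ac, bc`); in the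
second case, when port pairs are pairwise distinct (`hnopar`), it has at most three members.  This is the classical description of
pairwise intersecting families of 2-sets.

* `StarSet.sym2_eq_of_mem_of_mem` — a 2-set containing two distinct prescribed points is that pair;
* `StarSet.adjacent_family_star_or_triangle` — the dichotomy;
* `StarSet.adjacent_family_card_le_three_of_not_star` — a pairwise adjacent family through no common port has `≤ 3` classes.
-/

namespace Summit.CriticalPhenomena.PercolationContinuityZ3.Theorems

open Finset
open scoped BigOperators

namespace StarSet

variable {ι V : Type*}

/-- A port pair containing two distinct ports `u ≠ v` is `s(u, v)`. -/
theorem sym2_eq_of_mem_of_mem {p p' u v : V} (huv : u ≠ v) (hu : p = u ∨ p' = u) (hv : p = v ∨ p' = v) :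
    (s(p, p') : Sym2 V) = s(u, v) := by
  rcases hu with rfl | rfl <;> rcases hv with h | h
  · exact absurd h huv
  · subst h; rfl
  · subst h; exact Sym2.eq_swap
  · exact absurd h huv

/-- **L2.1 of U1-PROOF.md (Ω-cliques): a nonempty pairwise adjacent family of classes lies in a star or in a triangle.** -/
theorem adjacent_family_star_or_triangle (P P' : ι → V) (hPP' : ∀ X, P X ≠ P' X) (S : Finset ι) (hS : S.Nonempty)
    (hadj : ∀ X ∈ S, ∀ Y ∈ S, P X = P Y ∨ P X = P' Y ∨ P' X = P Y ∨ P' X = P' Y) :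
    (∃ v : V, ∀ X ∈ S, P X = v ∨ P' X = v) ∨
      ∃ a b c : V, a ≠ b ∧ a ≠ c ∧ b ≠ c ∧
        ∀ X ∈ S, (s(P X, P' X) : Sym2 V) = s(a, b) ∨ (s(P X, P' X) : Sym2 V) = s(a, c) ∨
          (s(P X, P' X) : Sym2 V) = s(b, c) := by
  classical
  obtain ⟨X₀, hX₀⟩ := hS
  set a := P X₀ with ha
  set b := P' X₀ with hb
  have hab : a ≠ b := hPP' X₀
  -- every class of `S` contains `a` or `b`
  have hab_mem : ∀ Y ∈ S, (P Y = a ∨ P' Y = a) ∨ (P Y = b ∨ P' Y = b) := by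
    intro Y hY
    rcases hadj Y hY X₀ hX₀ with h | h | h | h
    · exact Or.inl (Or.inl h)
    · exact Or.inr (Or.inl h)
    · exact Or.inl (Or.inr h)
    · exact Or.inr (Or.inr h)
  by_cases hstarA : ∀ Y ∈ S, P Y = a ∨ P' Y = a
  · exact Or.inl ⟨a, hstarA⟩
  by_cases hstarB : ∀ Y ∈ S, P Y = b ∨ P' Y = b
  · exact Or.inl ⟨b, hstarB⟩
  push Not at hstarA hstarB
  obtain ⟨Y₁, hY₁S, hY₁a, hY₁a'⟩ := hstarA
  obtain ⟨Y₂, hY₂S, hY₂b, hY₂b'⟩ := hstarB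
  -- `Y₁ = {b, c}` with `c ∉ {a, b}`
  have hY₁b : P Y₁ = b ∨ P' Y₁ = b := (hab_mem Y₁ hY₁S).resolve_left (not_or.2 ⟨hY₁a, hY₁a'⟩)
  have hY₂a : P Y₂ = a ∨ P' Y₂ = a := (hab_mem Y₂ hY₂S).resolve_right (not_or.2 ⟨hY₂b, hY₂b'⟩)
  -- the third port `c` of `Y₁`
  obtain ⟨c, hcY₁, hca, hcb⟩ : ∃ c, (P Y₁ = c ∨ P' Y₁ = c) ∧ c ≠ a ∧ c ≠ b := by
    rcases hY₁b with h | h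
    · refine ⟨P' Y₁, Or.inr rfl, hY₁a', ?_⟩
      rw [← h]; exact (hPP' Y₁).symm
    · refine ⟨P Y₁, Or.inl rfl, hY₁a, ?_⟩
      rw [← h]; exact hPP' Y₁
  -- the ports of `Y₁` are exactly `b` and `c`
  have hports₁ : ∀ q, (P Y₁ = q ∨ P' Y₁ = q) → q = b ∨ q = c := by
    intro q hq
    rcases hY₁b with h1 | h1
    · have hc' : P' Y₁ = c := hcY₁.resolve_left fun h => hcb (h.symm.trans h1)
      rcases hq with h3 | h3
      · exact Or.inl (h3.symm.trans h1)
      · exact Or.inr (h3.symm.trans hc')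
    · have hc' : P Y₁ = c := hcY₁.resolve_right fun h => hcb (h.symm.trans h1)
      rcases hq with h3 | h3
      · exact Or.inr (h3.symm.trans hc')
      · exact Or.inl (h3.symm.trans h1)
  -- `Y₂` is adjacent to `Y₁`, avoids `b`, so contains `c`
  have hY₂c : P Y₂ = c ∨ P' Y₂ = c := by
    rcases hadj Y₂ hY₂S Y₁ hY₁S with h | h | h | h
    · rcases hports₁ (P Y₂) (Or.inl h.symm) with h' | h'
      · exact absurd h' hY₂b
      · exact Or.inl h'
    · rcases hports₁ (P Y₂) (Or.inr h.symm) with h' | h'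
      · exact absurd h' hY₂b
      · exact Or.inl h'
    · rcases hports₁ (P' Y₂) (Or.inl h.symm) with h' | h'
      · exact absurd h' hY₂b'
      · exact Or.inr h'
    · rcases hports₁ (P' Y₂) (Or.inr h.symm) with h' | h'
      · exact absurd h' hY₂b'
      · exact Or.inr h'
  -- the ports of `Y₂` are exactly `a` and `c`
  have hports₂ : ∀ q, (P Y₂ = q ∨ P' Y₂ = q) → q = a ∨ q = c := by
    intro q hq
    rcases hY₂a with h1 | h1
    · have hc' : P' Y₂ = c := hY₂c.resolve_left fun h => hca (h.symm.trans h1)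
      rcases hq with h3 | h3
      · exact Or.inl (h3.symm.trans h1)
      · exact Or.inr (h3.symm.trans hc')
    · have hc' : P Y₂ = c := hY₂c.resolve_right fun h => hca (h.symm.trans h1)
      rcases hq with h3 | h3
      · exact Or.inr (h3.symm.trans hc')
      · exact Or.inl (h3.symm.trans h1)
  refine Or.inr ⟨a, b, c, hab, hca.symm, hcb.symm, fun Z hZ => ?_⟩
  -- `Z` meets `{a,b}`, `{b,c}` (ports of `Y₁`) and `{a,c}` (ports of `Y₂`)
  have hZab := hab_mem Z hZ
  -- `Z` contains `b` or `c`, and `a` or `c`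
  have hZbc : (P Z = b ∨ P' Z = b) ∨ (P Z = c ∨ P' Z = c) := by
    rcases hadj Z hZ Y₁ hY₁S with h | h | h | h
    · rcases hports₁ _ (Or.inl h.symm) with h' | h'
      · exact Or.inl (Or.inl h')
      · exact Or.inr (Or.inl h')
    · rcases hports₁ _ (Or.inr h.symm) with h' | h'
      · exact Or.inl (Or.inl h')
      · exact Or.inr (Or.inl h')
    · rcases hports₁ _ (Or.inl h.symm) with h' | h'
      · exact Or.inl (Or.inr h')
      · exact Or.inr (Or.inr h')
    · rcases hports₁ _ (Or.inr h.symm) with h' | h'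
      · exact Or.inl (Or.inr h')
      · exact Or.inr (Or.inr h')
  have hZac : (P Z = a ∨ P' Z = a) ∨ (P Z = c ∨ P' Z = c) := by
    rcases hadj Z hZ Y₂ hY₂S with h | h | h | h
    · rcases hports₂ _ (Or.inl h.symm) with h' | h'
      · exact Or.inl (Or.inl h')
      · exact Or.inr (Or.inl h')
    · rcases hports₂ _ (Or.inr h.symm) with h' | h'
      · exact Or.inl (Or.inl h')
      · exact Or.inr (Or.inl h')
    · rcases hports₂ _ (Or.inl h.symm) with h' | h'
      · exact Or.inl (Or.inr h')
      · exact Or.inr (Or.inr h')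
    · rcases hports₂ _ (Or.inr h.symm) with h' | h'
      · exact Or.inl (Or.inr h')
      · exact Or.inr (Or.inr h')
  rcases hZab with hZa | hZb
  · rcases hZbc with hZb | hZc
    · exact Or.inl (sym2_eq_of_mem_of_mem hab hZa hZb)
    · exact Or.inr (Or.inl (sym2_eq_of_mem_of_mem hca.symm hZa hZc))
  · rcases hZac with hZa | hZc
    · exact Or.inl (sym2_eq_of_mem_of_mem hab hZa hZb)
    · exact Or.inr (Or.inr (sym2_eq_of_mem_of_mem hcb.symm hZb hZc))

/-- **Corollary (L2.1): a pairwise adjacent family with no common port has at most three classes** (port pairs pairwise distinct). -/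
theorem adjacent_family_card_le_three_of_not_star [DecidableEq V] (P P' : ι → V) (hPP' : ∀ X, P X ≠ P' X)
    (hinj : Function.Injective fun X => (s(P X, P' X) : Sym2 V)) (S : Finset ι)
    (hadj : ∀ X ∈ S, ∀ Y ∈ S, P X = P Y ∨ P X = P' Y ∨ P' X = P Y ∨ P' X = P' Y)
    (hnostar : ¬ ∃ v : V, ∀ X ∈ S, P X = v ∨ P' X = v) : S.card ≤ 3 := by
  classical
  rcases S.eq_empty_or_nonempty with hS | hS
  · simp [hS]
  rcases adjacent_family_star_or_triangle P P' hPP' S hS hadj with hstar | ⟨a, b, c, _, _, _, htri⟩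
  · exact absurd hstar hnostar
  calc S.card = (S.image fun X => (s(P X, P' X) : Sym2 V)).card := (card_image_of_injective S hinj).symm
    _ ≤ ({s(a, b), s(a, c), s(b, c)} : Finset (Sym2 V)).card := by
        refine card_le_card fun e he => ?_
        obtain ⟨X, hX, rfl⟩ := mem_image.1 he
        rcases htri X hX with h | h | h <;> simp [h]
    _ ≤ 3 := card_le_three

end StarSet

end Summit.CriticalPhenomena.PercolationContinuityZ3.Theorems
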